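import Literature.Analysis.FluidPDE.CollisionalTransferTimeDep
import HarnessLib

/-!
# The space–time momentum balance of hard spheres on `T^d` (kinetic part of `Div M = 0`)

D. Serre encodes a hard-sphere motion in the space–time **mass–momentum tensor**
`M = Σ_p (1, v_p) ⊗ (1, v_p) dt|_{γ(p)} + collitons` over `ℝ_t × T^d_y` (Serre 2021; Serre 2024
§5 p. 1438) and feeds its row-wise `Div`-freeness into Compensated Integrability. Pairing the
particle part of `M` with the space–time gradient of a test vector field `Ψ = (ψ₀, ψ)`
(`ψ₀ : ℝ → T^d → ℝ` the time component, `ψ : ℝ → T^d → ℝ^d` the space components) gives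
`∫ Σ_p Σ_{α,β} u_α u_β ∂_β Ψ_α (t, x_p(t)) dt = ∫ Σ_p [(∂_t + v_p·∇) ψ₀ + ⟪(∂_t + v_p·∇) ψ, v_p⟫] dt`,
`u = (1, v_p)`: the streaming derivative of the **space–time momentum observable**
`F t z = Σ_p (ψ₀(t, x_p) + ⟪ψ(t, x_p), v_p⟫)`. This file proves the corresponding weak balance
law along a hard-sphere trajectory on the flat torus (`Torus.geometry d`) and its consequence
for test fields vanishing at the ends of the window: the particle part of `M` has divergence
`-Σ_coll ⟪ψ(t_c, x_i) - ψ(t_c, x_j), [v_i]⟫ δ_{t_c}` — exactly what the collitons compensate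
(Serre 2024 §5, "summing all these contributions results in a Div-free tensor").

* `Torus.stLiftAt ψ t x`, `Torus.stFDeriv ψ t x` — the space–time lift of `ψ : ℝ → T^d → F`
  re-centred at `(t, x)` and its Fréchet derivative there (`ℝ × ℝ^d →L[ℝ] F`), the space–time
  analogue of `FunctionSpaces.Torus.liftAt` / `Torus.fderiv`; `Torus.fderiv_stLift` (it is the
  derivative of the global lift `Torus.stLift ψ` at every lift of `x`);
  `Torus.hasDerivAt_stLift_flight` (chain rule along a free flight with absolute time:
  `d/ds ψ(s, x + proj((s - t₀) v)) = D ψ (s, ·) (1, v)`).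
* `stMomentumObservable ψ₀ ψ t z = Σ_i (ψ₀ t x_i + ⟪ψ t x_i, v_i⟫)` and its streaming derivative
  `stMomentumStreaming ψ₀ ψ t z = Σ_i (D ψ₀ (t, x_i) (1, v_i) + ⟪D ψ (t, x_i) (1, v_i), v_i⟫)`
  (`= ⟨(1, v_i) ⊗ (1, v_i), ∇_{t,y} Ψ⟩` summed over the particles);
  `hasDerivAt_stMomentumObservable_freeFlight`, `continuous_stMomentumStreaming_freeFlight`.
* `IsHardSphereTrajectory.collisionJump_stMomentumObservable` — the frozen-time jump is the jump
  of `momentumObservable (ψ t)` (positions do not jump), i.e. `⟪ψ(t, x_i) - ψ(t, x_j), [v_i]⟫`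
  at a binary collision (`collisionJump_momentumObservable`).
* **`IsHardSphereTrajectory.stMomentumObservable_sub_eq`** — the space–time weak momentum
  balance on `[a, b]`, and **`integral_stMomentumStreaming_eq_neg_finsum`** — for `Ψ(a, ·) =
  Ψ(b, ·) = 0`, `∫_a^b stMomentumStreaming dt = -Σᶠ_{t_c ∈ (a,b]} collisionJump (momentumObservable (ψ t_c)) γ t_c`.

Smoothness hypotheses: `ContDiff ℝ 1 (Torus.stLift ψ₀)` and `ContDiff ℝ 1 (Torus.stLift ψ)`
(joint `C¹` in `(t, y)`). Not here: the colliton identity turning each jump into a line integral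
of `⟪Dψ [v], [v]⟩ / |[v]|` over the contact segment, and any measure-theoretic packaging of `M`.

## References

* D. Serre, *Compensated integrability on tori; a priori estimate for space-periodic gas flows*,
  C. R. Math. Acad. Sci. Paris 362 (2024) 1425–1444, §5 p. 1438. [Serre2024]
* D. Serre, *Hard spheres dynamics: weak vs strong collisions*, ARMA 240 (2021) 243–264, §2
  (the mass–momentum tensor). [Serre2021]
* H. Spohn, *Large Scale Dynamics of Interacting Particles* (1991), Part I §3.2. [Spohn1991]
-/

open Set Filter Function MeasureTheory
open scoped InnerProductSpace Topology

namespace Literature.Analysis.FluidPDE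

noncomputable section

open Literature.Analysis.FunctionSpaces

section SpaceTime

section Lift

variable {d : Type*} {F : Type*}

/-! ## Space–time calculus on the torus through the re-centred lift -/

/-- The space–time lift of `ψ : ℝ → T^d → F` re-centred at `(t, x)`:
`(s, w) ↦ ψ (t + s) (x + proj w)` (space–time analogue of `Torus.liftAt`). [folklore] -/
def Torus.stLiftAt (ψ : ℝ → UnitAddTorus d → F) (t : ℝ) (x : UnitAddTorus d) :
    ℝ × EuclideanSpace ℝ d → F :=
  fun p => ψ (t + p.1) (x + Torus.proj p.2)

/-- Unfolding lemma for `Torus.stLiftAt`. [folklore] -/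
@[simp]
theorem Torus.stLiftAt_apply (ψ : ℝ → UnitAddTorus d → F) (t : ℝ) (x : UnitAddTorus d)
    (p : ℝ × EuclideanSpace ℝ d) : Torus.stLiftAt ψ t x p = ψ (t + p.1) (x + Torus.proj p.2) :=
  rfl

/-- The re-centred lift at `(t, proj y)` is the global space–time lift translated by `(t, y)`.
[folklore] -/
theorem Torus.stLiftAt_eq_comp_add (ψ : ℝ → UnitAddTorus d → F) (t : ℝ) {x : UnitAddTorus d}
    (y : EuclideanSpace ℝ d) (hy : Torus.proj y = x) :
    Torus.stLiftAt ψ t x = fun p => Torus.stLift ψ ((t, y) + p) := by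
  funext ⟨s, w⟩
  simp only [Torus.stLiftAt_apply, Prod.mk_add_mk, Torus.stLift_apply, Torus.proj_add, hy]

end Lift

variable {d : Type*} {F : Type*} [NormedAddCommGroup F] [NormedSpace ℝ F]

variable [Fintype d]

/-- The space–time Fréchet derivative of `ψ : ℝ → T^d → F` at `(t, x)`, a continuous linear map
`ℝ × ℝ^d →L[ℝ] F`: the derivative of the re-centred space–time lift at `0` (so that
`D ψ (t, x) (1, v) = ∂_t ψ + v · ∇ψ`). Junk value `0` where the lift is not differentiable.
[folklore] -/
def Torus.stFDeriv (ψ : ℝ → UnitAddTorus d → F) (t : ℝ) (x : UnitAddTorus d) :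
    ℝ × EuclideanSpace ℝ d →L[ℝ] F :=
  fderiv ℝ (Torus.stLiftAt ψ t x) 0

/-- The space–time derivative is the Fréchet derivative of the global lift `Torus.stLift ψ` at
every lift `(t, y)` of `(t, x)` (Mathlib `fderiv_comp_add_left`). [folklore] -/
theorem Torus.fderiv_stLift (ψ : ℝ → UnitAddTorus d → F) (t : ℝ) (y : EuclideanSpace ℝ d) :
    fderiv ℝ (Torus.stLift ψ) (t, y) = Torus.stFDeriv ψ t (Torus.proj y) := by
  rw [Torus.stFDeriv, Torus.stLiftAt_eq_comp_add ψ t y rfl, fderiv_comp_add_left, add_zero]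

/-- A jointly `C¹` field has `C¹` re-centred space–time lifts. [folklore] -/
theorem Torus.contDiff_stLiftAt {ψ : ℝ → UnitAddTorus d → F} {n : WithTop ℕ∞}
    (hψ : ContDiff ℝ n (Torus.stLift ψ)) (t : ℝ) (x : UnitAddTorus d) :
    ContDiff ℝ n (Torus.stLiftAt ψ t x) := by
  rw [Torus.stLiftAt_eq_comp_add ψ t (Torus.repr x) (Torus.proj_repr x)]
  exact hψ.comp ((contDiff_const (c := ((t, Torus.repr x) : ℝ × EuclideanSpace ℝ d))).add
    contDiff_id)

/-- **Chain rule along a free flight with absolute time.** For a jointly `C¹` field `ψ`,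
`s ↦ ψ s (x + proj ((s - t₀) • v))` has derivative `D ψ (s, x + proj((s - t₀) • v)) (1, v)` at
every `s` (the material derivative `∂_t ψ + v · ∇ψ` along the flight). [folklore] -/
theorem Torus.hasDerivAt_stLift_flight {ψ : ℝ → UnitAddTorus d → F}
    (hψ : ContDiff ℝ 1 (Torus.stLift ψ)) (x : UnitAddTorus d) (v : EuclideanSpace ℝ d)
    (t₀ s : ℝ) :
    HasDerivAt (fun σ : ℝ => ψ σ (x + Torus.proj ((σ - t₀) • v)))
      (Torus.stFDeriv ψ s (x + Torus.proj ((s - t₀) • v)) (1, v)) s := by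
  set y : EuclideanSpace ℝ d := Torus.repr x with hy
  have hc : HasDerivAt (fun σ : ℝ => ((σ, y + (σ - t₀) • v) : ℝ × EuclideanSpace ℝ d)) (1, v) s := by
    refine (hasDerivAt_id s).prodMk ?_
    have h1 : HasDerivAt (fun σ : ℝ => (σ - t₀) • v) ((1 : ℝ) • v) s :=
      ((hasDerivAt_id s).sub_const t₀).smul_const v
    rw [one_smul] at h1
    exact h1.const_add y
  have hd : HasFDerivAt (Torus.stLift ψ) (fderiv ℝ (Torus.stLift ψ) (s, y + (s - t₀) • v))
      (s, y + (s - t₀) • v) :=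
    ((hψ.differentiable one_ne_zero) _).hasFDerivAt
  have h := hd.comp_hasDerivAt s hc
  have hpt : Torus.proj (y + (s - t₀) • v) = x + Torus.proj ((s - t₀) • v) := by
    rw [Torus.proj_add, hy, Torus.proj_repr]
  rw [Torus.fderiv_stLift, hpt] at h
  refine h.congr_of_eventuallyEq (Eventually.of_forall fun σ => ?_)
  simp only [Function.comp_apply, Torus.stLift_apply, Torus.proj_add, hy, Torus.proj_repr]

/-- Along a free flight the space–time derivative of a jointly `C¹` field, applied to a fixed
vector, is continuous in time. [folklore] -/
theorem Torus.continuous_stFDeriv_flight {ψ : ℝ → UnitAddTorus d → F}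
    (hψ : ContDiff ℝ 1 (Torus.stLift ψ)) (x : UnitAddTorus d) (v : EuclideanSpace ℝ d) (t₀ : ℝ)
    (w : ℝ × EuclideanSpace ℝ d) :
    Continuous fun s : ℝ => Torus.stFDeriv ψ s (x + Torus.proj ((s - t₀) • v)) w := by
  have hcont : Continuous (fderiv ℝ (Torus.stLift ψ)) := hψ.continuous_fderiv one_ne_zero
  have hpath : Continuous fun s : ℝ => ((s, Torus.repr x + (s - t₀) • v) : ℝ × EuclideanSpace ℝ d) := by
    fun_prop
  have heq : (fun s : ℝ => Torus.stFDeriv ψ s (x + Torus.proj ((s - t₀) • v)) w) =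
      fun s => fderiv ℝ (Torus.stLift ψ) (s, Torus.repr x + (s - t₀) • v) w := by
    funext s
    rw [Torus.fderiv_stLift, Torus.proj_add, Torus.proj_repr]
  rw [heq]
  exact (hcont.comp hpath).clm_apply continuous_const

end SpaceTime

/-! ## The space–time momentum observable and its streaming derivative -/

section Observable

variable {d : Type*} [Fintype d] {N : ℕ}

/-- The **space–time momentum observable** of a test vector field `Ψ = (ψ₀, ψ)` on `ℝ × T^d`
frozen at time `t`: `Σ_i (ψ₀ t x_i + ⟪ψ t x_i, v_i⟫) = Σ_i ⟪(1, v_i), Ψ(t, x_i)⟫` — the particle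
part of Serre's mass–momentum tensor tested against `Ψ`, before differentiation.
[cite: Serre2024, §5 p. 1438] -/
def stMomentumObservable (ψ₀ : ℝ → UnitAddTorus d → ℝ) (ψ : ℝ → UnitAddTorus d → EuclideanSpace ℝ d)
    (t : ℝ) (z : Config N d (UnitAddTorus d)) : ℝ :=
  ∑ i, (ψ₀ t (z i).1 + ⟪ψ t (z i).1, (z i).2⟫_ℝ)

/-- The **space–time streaming momentum flux**: `Σ_i (D ψ₀ (t, x_i) (1, v_i) +
⟪D ψ (t, x_i) (1, v_i), v_i⟫) = Σ_i ⟨(1, v_i) ⊗ (1, v_i), ∇_{t,y} Ψ (t, x_i)⟩`, the pairing of the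
particle part of the mass–momentum tensor with the space–time gradient of `Ψ = (ψ₀, ψ)`.
[cite: Serre2024, §5 p. 1438] -/
def stMomentumStreaming (ψ₀ : ℝ → UnitAddTorus d → ℝ) (ψ : ℝ → UnitAddTorus d → EuclideanSpace ℝ d)
    (t : ℝ) (z : Config N d (UnitAddTorus d)) : ℝ :=
  ∑ i, (Torus.stFDeriv ψ₀ t (z i).1 (1, (z i).2) + ⟪Torus.stFDeriv ψ t (z i).1 (1, (z i).2), (z i).2⟫_ℝ)

/-- The space–time momentum observable is a position observable plus the momentum observable
of the frozen field `ψ t`. [folklore] -/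
theorem stMomentumObservable_eq (ψ₀ : ℝ → UnitAddTorus d → ℝ)
    (ψ : ℝ → UnitAddTorus d → EuclideanSpace ℝ d) (t : ℝ) (z : Config N d (UnitAddTorus d)) :
    stMomentumObservable ψ₀ ψ t z = (∑ i, ψ₀ t (z i).1) + momentumObservable (ψ t) z := by
  simp only [stMomentumObservable, momentumObservable, Finset.sum_add_distrib]

variable {ψ₀ : ℝ → UnitAddTorus d → ℝ} {ψ : ℝ → UnitAddTorus d → EuclideanSpace ℝ d}

/-- **Streaming derivative of the space–time momentum observable** along a free flight with
absolute time: `d/ds F s (S_{s-t₀} z) = stMomentumStreaming ψ₀ ψ s (S_{s-t₀} z)`. [folklore] -/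
theorem hasDerivAt_stMomentumObservable_freeFlight (hψ₀ : ContDiff ℝ 1 (Torus.stLift ψ₀))
    (hψ : ContDiff ℝ 1 (Torus.stLift ψ)) (z : Config N d (UnitAddTorus d)) (t₀ t : ℝ) :
    HasDerivAt (fun s => stMomentumObservable ψ₀ ψ s (freeFlight (Torus.geometry d) (s - t₀) z))
      (stMomentumStreaming ψ₀ ψ t (freeFlight (Torus.geometry d) (t - t₀) z)) t := by
  simp only [stMomentumObservable, stMomentumStreaming, freeFlight_apply, Torus.geometry_translate]
  refine HasDerivAt.fun_sum fun i _ => ?_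
  have h0 := Torus.hasDerivAt_stLift_flight hψ₀ (z i).1 (z i).2 t₀ t
  have h1 := (Torus.hasDerivAt_stLift_flight hψ (z i).1 (z i).2 t₀ t).inner ℝ
    (hasDerivAt_const t (z i).2)
  simp only [inner_zero_right, zero_add] at h1
  exact h0.add h1

/-- The space–time streaming flux is continuous along a free flight (jointly `C¹` fields).
[folklore] -/
theorem continuous_stMomentumStreaming_freeFlight (hψ₀ : ContDiff ℝ 1 (Torus.stLift ψ₀))
    (hψ : ContDiff ℝ 1 (Torus.stLift ψ)) (z : Config N d (UnitAddTorus d)) (t₀ : ℝ) :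
    Continuous fun t => stMomentumStreaming ψ₀ ψ t (freeFlight (Torus.geometry d) (t - t₀) z) := by
  simp only [stMomentumStreaming, freeFlight_apply, Torus.geometry_translate]
  refine continuous_finsetSum _ fun i _ => ?_
  exact (Torus.continuous_stFDeriv_flight hψ₀ (z i).1 (z i).2 t₀ _).add
    ((Torus.continuous_stFDeriv_flight hψ (z i).1 (z i).2 t₀ _).inner continuous_const)

end Observable

/-! ## Along a hard-sphere trajectory on the torus -/

namespace IsHardSphereTrajectory

variable {d : Type*} [Fintype d] {N : ℕ} {ε : ℝ} {γ : ℝ → Config N d (UnitAddTorus d)}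
  {ψ₀ : ℝ → UnitAddTorus d → ℝ} {ψ : ℝ → UnitAddTorus d → EuclideanSpace ℝ d}

/-- Each translation of the torus geometry is continuous. [folklore] -/
private theorem torus_continuous_translate' (x : UnitAddTorus d) :
    Continuous ((Torus.geometry d).translate x) :=
  continuous_const.add Torus.continuous_proj

/-- The frozen-time jump of the space–time momentum observable at time `t` is the jump of the
momentum observable of the frozen field `ψ t` (positions, hence the `ψ₀`-part, do not jump).
[folklore] -/
theorem collisionJump_stMomentumObservable (h : IsHardSphereTrajectory (Torus.geometry d) ε N γ)
    (t : ℝ) :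
    collisionJump (stMomentumObservable ψ₀ ψ t) γ t = collisionJump (momentumObservable (ψ t)) γ t := by
  have hpos : ∀ k, (leftLim γ t k).1 = (γ t k).1 := h.leftLim_apply_fst torus_continuous_translate' t
  simp only [collisionJump, stMomentumObservable_eq, hpos]
  abel

/-- At a binary collision of the pair `{i, j}` at time `t` the frozen-time jump is
`⟪ψ(t, x_i) - ψ(t, x_j), v_i⁺ - v_i⁻⟫` — the momentum `[v]` exchanged by the pair paired with the
difference of the test field at the two centres (Serre 2024 §5: this is what the colliton on the
segment `[x_j, x_i]` compensates). [cite: Serre2024, §5 p. 1438] -/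
theorem collisionJump_stMomentumObservable_eq_inner
    (h : IsHardSphereTrajectory (Torus.geometry d) ε N γ) {t : ℝ} {i j : Fin N} (hij : i ≠ j)
    (hc : γ t ∈ contactSet (Torus.geometry d) N ε i j) :
    collisionJump (stMomentumObservable ψ₀ ψ t) γ t =
      ⟪ψ t (γ t i).1 - ψ t (γ t j).1, (γ t i).2 - (leftLim γ t i).2⟫_ℝ := by
  rw [h.collisionJump_stMomentumObservable t,
    h.collisionJump_momentumObservable torus_continuous_translate' (ψ t) hij hc]

/-- **The space–time weak momentum balance along a hard-sphere trajectory on `T^d`.** For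
jointly `C¹` test fields `ψ₀, ψ` and `a ≤ b`:
`Σ_i (ψ₀ b x_i(b) + ⟪ψ b x_i(b), v_i(b)⟫) - Σ_i (ψ₀ a x_i(a) + ⟪ψ a x_i(a), v_i(a)⟫)
  = ∫_a^b Σ_i (Dψ₀ (1, v_i) + ⟪Dψ (1, v_i), v_i⟫)(s, x_i(s)) ds
    + Σᶠ_{t_c ∈ (a, b]} collisionJump (momentumObservable (ψ t_c)) γ t_c`
(kinetic space–time momentum flux plus the collisional transfer of the frozen fields).
[cite: Serre2024, §5 p. 1438] -/
theorem stMomentumObservable_sub_eq (h : IsHardSphereTrajectory (Torus.geometry d) ε N γ)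
    (hψ₀ : ContDiff ℝ 1 (Torus.stLift ψ₀)) (hψ : ContDiff ℝ 1 (Torus.stLift ψ)) {a b : ℝ}
    (hab : a ≤ b) :
    IntervalIntegrable (fun s => stMomentumStreaming ψ₀ ψ s (γ s)) volume a b ∧
      stMomentumObservable ψ₀ ψ b (γ b) - stMomentumObservable ψ₀ ψ a (γ a) =
        (∫ s in a..b, stMomentumStreaming ψ₀ ψ s (γ s)) +
          ∑ᶠ t ∈ collisionTimes (Torus.geometry d) ε γ ∩ Ioc a b,
            collisionJump (momentumObservable (ψ t)) γ t := by
  obtain ⟨hint, heq⟩ := h.sub_eq_integral_add_finsum_collisionJump_td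
    (F := stMomentumObservable ψ₀ ψ) (F' := stMomentumStreaming ψ₀ ψ) torus_continuous_translate'
    (hasDerivAt_stMomentumObservable_freeFlight hψ₀ hψ)
    (continuous_stMomentumStreaming_freeFlight hψ₀ hψ) hab
  refine ⟨hint, ?_⟩
  rw [heq]
  congr 1
  exact finsum_mem_congr rfl fun t _ => h.collisionJump_stMomentumObservable t

/-- **Kinetic part of `Div M = 0` (tested).** If the test fields vanish at the ends of the
window, `ψ₀ a = ψ₀ b = 0` and `ψ a = ψ b = 0` on `T^d`, then the particle part of the
mass–momentum tensor paired with `∇_{t,y} Ψ` is minus the collisional transfer of the frozen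
fields: `∫_a^b stMomentumStreaming dt = -Σᶠ_{t_c ∈ (a,b]} collisionJump (momentumObservable (ψ t_c)) γ t_c`,
each jump being `⟪ψ(t_c, x_i) - ψ(t_c, x_j), [v_i]⟫` (`collisionJump_stMomentumObservable_eq_inner`).
[cite: Serre2024, §5 p. 1438] -/
theorem integral_stMomentumStreaming_eq_neg_finsum
    (h : IsHardSphereTrajectory (Torus.geometry d) ε N γ)
    (hψ₀ : ContDiff ℝ 1 (Torus.stLift ψ₀)) (hψ : ContDiff ℝ 1 (Torus.stLift ψ)) {a b : ℝ}
    (hab : a ≤ b) (ha₀ : ψ₀ a = 0) (hb₀ : ψ₀ b = 0) (ha : ψ a = 0) (hb : ψ b = 0) :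
    (∫ s in a..b, stMomentumStreaming ψ₀ ψ s (γ s)) =
      -∑ᶠ t ∈ collisionTimes (Torus.geometry d) ε γ ∩ Ioc a b,
        collisionJump (momentumObservable (ψ t)) γ t := by
  have heq := (h.stMomentumObservable_sub_eq hψ₀ hψ hab).2
  have hFa : stMomentumObservable ψ₀ ψ a (γ a) = 0 := by
    simp [stMomentumObservable, ha₀, ha]
  have hFb : stMomentumObservable ψ₀ ψ b (γ b) = 0 := by
    simp [stMomentumObservable, hb₀, hb]
  rw [hFa, hFb, sub_zero] at heq
  linarith

end IsHardSphereTrajectory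

end

end Literature.Analysis.FluidPDE
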